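import Summits.Ventures.CertifiedManyBodySolver.Certificates.SymRungV0core.Defs
import Summits.Ventures.CertifiedManyBodySolver.Certificates.SymRungV0core.Data.P0a0
import Summits.Ventures.CertifiedManyBodySolver.Certificates.SymRungV0core.Data.P0a1
import Summits.Ventures.CertifiedManyBodySolver.Certificates.SymRungV0core.Data.P0a2
import Summits.Ventures.CertifiedManyBodySolver.Certificates.SymRungV0core.Data.P0a3
import Summits.Ventures.CertifiedManyBodySolver.Certificates.SymRungV0core.Data.P0a4
import Summits.Ventures.CertifiedManyBodySolver.Certificates.SymRungV0core.Data.P0a5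
import Summits.Ventures.CertifiedManyBodySolver.Certificates.SymRungV0core.Data.P0b0
import Summits.Ventures.CertifiedManyBodySolver.Certificates.SymRungV0core.Data.P0b1
import Summits.Ventures.CertifiedManyBodySolver.Certificates.SymRungV0core.Data.P0b2
import Summits.Ventures.CertifiedManyBodySolver.Certificates.SymRungV0core.Data.P0b3
import Summits.Ventures.CertifiedManyBodySolver.Certificates.SymRungV0core.Data.P0b4
import Summits.Ventures.CertifiedManyBodySolver.Certificates.SymRungV0core.Data.P0b5
import Summits.Ventures.CertifiedManyBodySolver.Certificates.SymRungV0core.Data.P0b6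
import Summits.Ventures.CertifiedManyBodySolver.Certificates.SymRungV0core.Data.P1a0
import Summits.Ventures.CertifiedManyBodySolver.Certificates.SymRungV0core.Data.P1a1
import Summits.Ventures.CertifiedManyBodySolver.Certificates.SymRungV0core.Data.P1a2
import Summits.Ventures.CertifiedManyBodySolver.Certificates.SymRungV0core.Data.P1a3
import Summits.Ventures.CertifiedManyBodySolver.Certificates.SymRungV0core.Data.P1a4
import Summits.Ventures.CertifiedManyBodySolver.Certificates.SymRungV0core.Data.P1a5
import Summits.Ventures.CertifiedManyBodySolver.Certificates.SymRungV0core.Data.P1b0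
import Summits.Ventures.CertifiedManyBodySolver.Certificates.SymRungV0core.Data.P1b1
import Summits.Ventures.CertifiedManyBodySolver.Certificates.SymRungV0core.Data.P1b2
import Summits.Ventures.CertifiedManyBodySolver.Certificates.SymRungV0core.Data.P1b3
import Summits.Ventures.CertifiedManyBodySolver.Certificates.SymRungV0core.Data.P1b4
import Summits.Ventures.CertifiedManyBodySolver.Certificates.SymRungV0core.Data.P1b5
import Summits.Ventures.CertifiedManyBodySolver.Certificates.SymRungV0core.Data.P2a0
import Summits.Ventures.CertifiedManyBodySolver.Certificates.SymRungV0core.Data.P2a1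
import Summits.Ventures.CertifiedManyBodySolver.Certificates.SymRungV0core.Data.P2a2
import Summits.Ventures.CertifiedManyBodySolver.Certificates.SymRungV0core.Data.P2a3
import Summits.Ventures.CertifiedManyBodySolver.Certificates.SymRungV0core.Data.P2a4
import Summits.Ventures.CertifiedManyBodySolver.Certificates.SymRungV0core.Data.P2a5
import Summits.Ventures.CertifiedManyBodySolver.Certificates.SymRungV0core.Data.P2b0
import Summits.Ventures.CertifiedManyBodySolver.Certificates.SymRungV0core.Data.P2b1
import Summits.Ventures.CertifiedManyBodySolver.Certificates.SymRungV0core.Data.P2b2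
import Summits.Ventures.CertifiedManyBodySolver.Certificates.SymRungV0core.Data.P2b3
import Summits.Ventures.CertifiedManyBodySolver.Certificates.SymRungV0core.Data.P2b4
import Summits.Ventures.CertifiedManyBodySolver.Certificates.SymRungV0core.Data.P2b5
import Summits.Ventures.CertifiedManyBodySolver.Certificates.SymRungV0core.Data.P2b6

/-!
# Rung V = v0′ (CORE) — RESHAPED shard partition (J = 6 Gram groups) and the reuse of the landed base fact
The gate's accept elaboration is capped at 600 s; none of the three Gram groups of the J = 3 partition (`sizes = [26, 29]`; 26 / 29 / 30
R-blocks, ≈ 0.5 M products each) fits (Fact1 p643934, Fact2 p643965 / p644886 bounced «elaboration timed out after 600s»).  This module splits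
every group into cost halves: `sizes2 = [1, 25, 2, 27, 2]` (runs of 1 | 25 | 2 | 27 | 2 | 28 R-blocks of the landed J3 = LPT order, cut by product
count: the leading block(s) of each J = 3 group carry about half of its products; run 0 is the single largest R-block `mm.c0/66`, 256 080 products), ships the six
sub-partials `Pg0a Pg0b Pg1a Pg1b Pg2a Pg2b` (computed by the tree's own `dropZeros ∘ collect ∘ canonNFZB lo hi ∘ shardPolyAtRGFast` on the farm and
read back from v2 token chunks `p0a* p0b* p1a* p1b* p2a* p2b*`), keeps `Pbase` (and, inside it, `Pg0`, `Pg1`, `Pg2`) of `…Defs` unchanged, and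
proves the structural identity by which `…Cert` transports the LANDED base fact (`fact0`, stated for `sizes`) to `sizes2` (shard 0 does not
depend on how the runs are cut).  No bound of record moves by this module (#529 −0.8295699476 stays the certified row); the rung value −0.8942613 is 0.064 BELOW the −83/100 edge (stmt-Ventures-22024 NOT closed); computational grade (`native_decide`); no summit or crux statement is proved here; nothing here predicts superconductivity.
-/

namespace Summit.Ventures.CertifiedManyBodySolver.Certificates.SymRungV0core

open Summit.Ventures.CertifiedManyBodySolver.Theorems.SymReplay

/-- J = 6 Gram groups: runs of 1, 25, 2, 27, 2 R-blocks and the remainder (28). -/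
def sizes2 : List ℕ := [1, 25, 2, 27, 2]

/-- Shipped sub-partial of Gram group 0a (R-block 0 of the J3 order = `mm.c0/66` alone; v2 slot-polys tokens). -/
def Pg0a : QPoly := ((rdSlotPolys (siteTab cert.frame) (toksOf [p0a0, p0a1, p0a2, p0a3, p0a4, p0a5])).1).headD []

/-- Shipped sub-partial of Gram group 0b (R-blocks 1–25). -/
def Pg0b : QPoly := ((rdSlotPolys (siteTab cert.frame) (toksOf [p0b0, p0b1, p0b2, p0b3, p0b4, p0b5, p0b6])).1).headD []

/-- Shipped sub-partial of Gram group 1a (R-blocks 26–27). -/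
def Pg1a : QPoly := ((rdSlotPolys (siteTab cert.frame) (toksOf [p1a0, p1a1, p1a2, p1a3, p1a4, p1a5])).1).headD []

/-- Shipped sub-partial of Gram group 1b (R-blocks 28–54). -/
def Pg1b : QPoly := ((rdSlotPolys (siteTab cert.frame) (toksOf [p1b0, p1b1, p1b2, p1b3, p1b4, p1b5])).1).headD []

/-- Shipped sub-partial of Gram group 2a (R-blocks 55–56). -/
def Pg2a : QPoly := ((rdSlotPolys (siteTab cert.frame) (toksOf [p2a0, p2a1, p2a2, p2a3, p2a4, p2a5])).1).headD []

/-- Shipped sub-partial of Gram group 2b (R-blocks 57–84). -/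
def Pg2b : QPoly := ((rdSlotPolys (siteTab cert.frame) (toksOf [p2b0, p2b1, p2b2, p2b3, p2b4, p2b5, p2b6])).1).headD []

/-- The partials in reshaped shard order (base, groups 0a, 0b, 1a, 1b, 2a, 2b); `Pbase` is the literal of `…Defs`. -/
def Ps2 : List QPoly := [Pbase, Pg0a, Pg0b, Pg1a, Pg1b, Pg2a, Pg2b]

/-- The base certificate carries exactly one local shard (the base shard; `gramM = []`). -/
theorem shardCount_eq : shardCount cert.toSymCert cpar = 1 := by native_decide

/-- Seven shards: base + six Gram groups. -/
theorem hcount2 : shardCountRG cert cpar sizes2 = Ps2.length := by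
  rw [shardCountRG, shardCount_eq]; rfl

/-- Sub-partial sizes (terms). -/
theorem subpartial_lengths : (Pg0a.length, Pg0b.length, Pg1a.length, Pg1b.length, Pg2a.length, Pg2b.length) = (24559, 27898, 24680, 23026, 24455, 28489) := by native_decide

/-- Shard 0 (the base shard) is the same polynomial under both partitions (`sizes` of `…Defs` and `sizes2`). -/
theorem shardPolyAtRGFast_sizes2_zero : shardPolyAtRGFast cert cpar sizes2 0 = shardPolyAtRGFast cert cpar sizes 0 := by
  unfold shardPolyAtRGFast
  rw [shardCount_eq, if_pos Nat.zero_lt_one, if_pos Nat.zero_lt_one]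

end Summit.Ventures.CertifiedManyBodySolver.Certificates.SymRungV0core
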